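import Summits.KontsevichZagierPeriods.Zeta5Search.LaiSweepShard

/-!
# `κ₃` sweep certificate — shard file 116 of 127 (shards 812–818 of 889)

HONEST FRAMING. Systematic search; no irrationality claim unless certified. This file only checks,
by `decide +kernel`, shards 812–818 of the order-cell sweep of the `κ₃` point `(74, 2180, 444; δ74)`
(engine `LaiSweepEngine`, soundness `LaiSweepJump/Free/Eval/Shard/Kappa3`; a shard is `⟨regime, n,
p, q, p', q', Lo, Up⟩`: `n` cells from `p/q` to `p'/q'` with integer rate sums in `[Lo, Up]`, `K =
128`, `D = 2^40`). It draws NO conclusion: only the capstone `LaiKappa3SweepCert`, which needs all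
127 shard files, does. Kernel cost of this file ≈ 560 cells × 0.3 s.
-/

namespace Summit.KontsevichZagierPeriods.Zeta5Search.Sweep

set_option maxHeartbeats 100000000 in
/-- Shard 812: 80 cells of regime B from `4341/4804` to `276/305`.
[cite: Lai2024BallRivoal, §4 Lemma 4.3] -/
theorem shard812 :
    Shard.check 128 (2^40)
      ⟨true, 80, 4341, 4804, 276, 305, 10760938394823, 18242645994046⟩ = true := by
  decide +kernel

set_option maxHeartbeats 100000000 in
/-- Shard 813: 80 cells of regime B from `276/305` to `222/245`.
[cite: Lai2024BallRivoal, §4 Lemma 4.3] -/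
theorem shard813 :
    Shard.check 128 (2^40)
      ⟨true, 80, 276, 305, 222, 245, 9993839324855, 16959565148910⟩ = true := by
  decide +kernel

set_option maxHeartbeats 100000000 in
/-- Shard 814: 80 cells of regime B from `222/245` to `49/54`.
[cite: Lai2024BallRivoal, §4 Lemma 4.3] -/
theorem shard814 :
    Shard.check 128 (2^40)
      ⟨true, 80, 222, 245, 49, 54, 10655368756250, 18100758319847⟩ = true := by
  decide +kernel

set_option maxHeartbeats 100000000 in
/-- Shard 815: 80 cells of regime B from `49/54` to `179/197`.
[cite: Lai2024BallRivoal, §4 Lemma 4.3] -/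
theorem shard815 :
    Shard.check 128 (2^40)
      ⟨true, 80, 49, 54, 179, 197, 10125717548884, 17218719367138⟩ = true := by
  decide +kernel

set_option maxHeartbeats 100000000 in
/-- Shard 816: 80 cells of regime B from `179/197` to `192/211`.
[cite: Lai2024BallRivoal, §4 Lemma 4.3] -/
theorem shard816 :
    Shard.check 128 (2^40)
      ⟨true, 80, 179, 197, 192, 211, 10953089711860, 18645387212937⟩ = true := by
  decide +kernel

set_option maxHeartbeats 100000000 in
/-- Shard 817: 80 cells of regime B from `192/211` to `277/304`.
[cite: Lai2024BallRivoal, §4 Lemma 4.3] -/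
theorem shard817 :
    Shard.check 128 (2^40)
      ⟨true, 80, 192, 211, 277, 304, 10189376870470, 17363347934522⟩ = true := by
  decide +kernel

set_option maxHeartbeats 100000000 in
/-- Shard 818: 80 cells of regime B from `277/304` to `198/217`.
[cite: Lai2024BallRivoal, §4 Lemma 4.3] -/
theorem shard818 :
    Shard.check 128 (2^40)
      ⟨true, 80, 277, 304, 198, 217, 10403544701020, 17746456510506⟩ = true := by
  decide +kernel

/-- The checked shards of this file, in order. [folklore] -/
def shards116 : List (CheckedShard 128 (2^40)) :=
  [⟨_, shard812⟩, ⟨_, shard813⟩, ⟨_, shard814⟩, ⟨_, shard815⟩, ⟨_, shard816⟩,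
    ⟨_, shard817⟩, ⟨_, shard818⟩]

end Summit.KontsevichZagierPeriods.Zeta5Search.Sweep
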